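import Summits.QuantumFields.QCD.Theorems.WilsonMobilityGapMobilityGapPinchPionBlock
import Literature.MathematicalPhysics.QuantumFieldTheory.QCDPhaseQuenchedPositivity
import Literature.MathematicalPhysics.QuantumFieldTheory.QCDPhaseQuenchedMomentUpgrade

/-!
# Crux `ChiralMobilityGap` (stmt-QuantumFields-17497), line `Sketch`, stub C `stub_momentCompare`:
# the `s`-moment of the propagator entry sum bounds the pion second moment from below

At a DEGENERATE bare tuple `(t,…,t)` with `N_f ≥ 2` flavours, for `0 < s ≤ 1`,
`E₊[(Σ|G_f|)^s]^{2/s} ≤ 144 · E₊[Σ|G_f|²]` (`E₊` the phase-quenched expectation on the torus of side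
`2S+1`, `G_f` the colour–spin block of the flavour-`f` quark propagator from `0` to `v`).

Proof.
* LYAPUNOV under the phase-quenched probability measure `qcdLatticeMeasure`:
  `E₊[P^s] ≤ E₊[P^2]^{s/2}` (`qcdPhaseQuenchedExpect_rpow_le_rpow`), `P = propSum` the entry sum; raise to
  the power `2/s`.
* `ℓ¹/ℓ²` on the `144` colour–spin entries: `P² ≤ 144 Σ|G|²` configuration-wise
  (`MobilityGapPinch.sum_sq_le_sq_sum_le`) and monotonicity of the integral.
* INTEGRABILITY of `Σ|G|²` (the heart; this is where `N_f ≥ 2` and degeneracy enter): `diracMatrix` is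
  flavour-diagonal with `N_f` identical blocks `D_W = D_W(U,t,1)`, so `|det D| = |det D_W|^{N_f}` and the
  flavour-`f` entries of `D⁻¹` are those of `D_W⁻¹` (`inv_diracMatrix_apply_same_flavour`; at singular `D_W`
  both sides of the bound below vanish).  With `|det A|·|A⁻¹(p,q)| ≤ |adj A(p,q)|`
  (`norm_det_mul_norm_inv_apply_le`):
  `|det D|·|G(p,q)|² = |det D_W|^{N_f-2} (|det D_W|·|D_W⁻¹(p,q)|)² ≤ |det D_W|^{N_f-2} |adj D_W(p,q)|²`, bounded on
  the compact configuration space; a measurable observable with bounded `|det D|·φ` is integrable under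
  `qcdLatticeMeasure = c • (wilsonWeight.withDensity |det D|)` (bookkeeping of
  `integrable_norm_inv_diracMatrix_apply_qcdLatticeMeasure`).
-/

noncomputable section

namespace Summit.QuantumFields.QCD.Theorems.ChiralMobilityGapSketch

open scoped BigOperators Topology
open MeasureTheory Filter Set
open Literature.MathematicalPhysics.QuantumFieldTheory Literature.MathematicalPhysics.QuantumLattice
  Literature.Probability.LatticeModels
open Summit.QuantumFields.QCD.Theorems.MobilityGapNegative (bare fm Clauses Lower Sign)
open Summit.QuantumFields.QCD.Theorems.MobilityGapSketch (propSum propSum_nonneg measurable_propSum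
  integrable_propSum_rpow fm_eq_expect negativeFm_eq_fm)

/-! ### §1 Phase-quenched integrability from a bound on `|det D| · φ` -/

/-- A non-negative measurable observable `φ` whose product with the phase-quenched weight `|det D|` is
bounded on the configuration space is integrable under the phase-quenched probability measure
`qcdLatticeMeasure S β mq = c • (wilsonWeight.withDensity |det D|)` (the Wilson weight is finite). -/
theorem integrable_qcdLatticeMeasure_of_norm_det_mul_le {Nf S : ℕ} [NeZero S] (β : ℝ) (mq : Fin Nf → ℝ)
    (φ : GaugeConfig 4 S SU3 → ℝ) (hφm : Measurable φ) (hφ0 : ∀ U, 0 ≤ φ U) {C : ℝ}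
    (hC : ∀ U, ‖(diracMatrix U mq).det‖ * φ U ≤ C) :
    Integrable φ (qcdLatticeMeasure S β mq) := by
  obtain ⟨hZ0, hZT⟩ := partitionFunction_fundamental_ne_zero_and_ne_top (S := S) β
  -- finiteness of the Wilson weight
  haveI : IsFiniteMeasure (wilsonWeight (d := 4) (L := S) (fundamentalRep (Fin 3)) β) :=
    ⟨by simpa [partitionFunction] using hZT.lt_top⟩
  -- the density `|det D| = ∏_f |det D_W(m_f)|`
  have hdens : Measurable fun U : GaugeConfig 4 S SU3 =>
      ENNReal.ofReal (∏ f, ‖fermionDet (wilsonDirac (fundamentalRep (Fin 3)) U (mq f) 1)‖) := by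
    have := measurable_norm_det_diracMatrix (S := S) mq
    simp_rw [norm_det_diracMatrix] at this
    exact this.ennreal_ofReal
  -- integrability against the un-normalised weight `|det D| dwilsonWeight`
  have hW : Integrable φ (qcdLatticeWeight S β mq) := by
    rw [qcdLatticeWeight, integrable_withDensity_iff_integrable_smul' hdens
      (Eventually.of_forall fun _ => ENNReal.ofReal_lt_top)]
    refine Integrable.of_bound (C := C) ?_ (Eventually.of_forall fun U => ?_)
    · exact ((hdens.ennreal_toReal).smul hφm).aestronglyMeasurable
    · have h0 : 0 ≤ ∏ f, ‖fermionDet (wilsonDirac (fundamentalRep (Fin 3)) U (mq f) 1)‖ :=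
        Finset.prod_nonneg fun f _ => norm_nonneg _
      rw [ENNReal.toReal_ofReal h0, ← norm_det_diracMatrix, smul_eq_mul, Real.norm_eq_abs,
        abs_of_nonneg (mul_nonneg (norm_nonneg _) (hφ0 U))]
      exact hC U
  -- normalisation (the total weight is positive at every parameter)
  have huniv : qcdLatticeWeight S β mq Set.univ ≠ 0 := by
    rw [qcdLatticeWeight_univ]
    exact mul_ne_zero hZ0 (ENNReal.ofReal_pos.2 (integral_norm_det_diracMatrix_pos_all β mq)).ne'
  rw [qcdLatticeMeasure]
  exact hW.smul_measure (ENNReal.inv_ne_top.2 huniv)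

/-! ### §2 The bound `|det D| · |G_f(p,q)|² ≤ |det D_W|^{N_f-2} |adj D_W(p,q)|²` at a degenerate tuple -/

/-- Matrix algebra: `|det A|^N · |A⁻¹(p,q)|² ≤ B^{N-2} C²` whenever `N ≥ 2`, `|det A| ≤ B` and
`|adj A(p,q)| ≤ C` (from `|det A|·|A⁻¹(p,q)| ≤ |adj A(p,q)|`). -/
theorem norm_det_pow_mul_norm_inv_sq_le {n : Type*} [Fintype n] [DecidableEq n] (A : Matrix n n ℂ)
    (p q : n) {N : ℕ} (hN : 2 ≤ N) {B C : ℝ} (hB : ‖A.det‖ ≤ B) (hC : ‖A.adjugate p q‖ ≤ C) :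
    ‖A.det‖ ^ N * ‖A⁻¹ p q‖ ^ 2 ≤ B ^ (N - 2) * C ^ 2 := by
  have hsplit : ‖A.det‖ ^ (N - 2) * (‖A.det‖ * ‖A⁻¹ p q‖) ^ 2 = ‖A.det‖ ^ N * ‖A⁻¹ p q‖ ^ 2 := by
    rw [mul_pow, ← mul_assoc, ← pow_add, Nat.sub_add_cancel hN]
  rw [← hsplit]
  have hB0 : 0 ≤ B := (norm_nonneg _).trans hB
  exact mul_le_mul (pow_le_pow_left₀ (norm_nonneg _) hB _)
    (pow_le_pow_left₀ (mul_nonneg (norm_nonneg _) (norm_nonneg _))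
      ((norm_det_mul_norm_inv_apply_le A p q).trans hC) 2)
    (sq_nonneg _) (pow_nonneg hB0 _)

/-- **The degenerate-tuple bound.** For `N_f ≥ 2` identical flavours of bare mass `t`,
`|det D(U)| · |D(U)⁻¹((f,p),(f,q))|² ≤ B^{N_f-2} C²` as soon as `|det D_W(U,t,1)| ≤ B` and
`|adj D_W(U,t,1)(p,q)| ≤ C` (`|det D| = |det D_W|^{N_f}`; the flavour-`f` block of `D⁻¹` is `D_W⁻¹`; at
singular `D_W` the left-hand side vanishes). -/
theorem norm_det_diracMatrix_mul_norm_inv_sq_le {Nf S : ℕ} [NeZero S] (hNf : 2 ≤ Nf) (t : ℝ) (f : Fin Nf)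
    (p q : TorusSite 4 S × Fin 3 × Fin 4) (U : GaugeConfig 4 S SU3) {B C : ℝ}
    (hB : ‖(wilsonDirac (fundamentalRep (Fin 3)) U t 1).det‖ ≤ B)
    (hC : ‖(wilsonDirac (fundamentalRep (Fin 3)) U t 1).adjugate p q‖ ≤ C) :
    ‖(diracMatrix U (fun _ : Fin Nf => t)).det‖ *
        ‖(diracMatrix U (fun _ : Fin Nf => t))⁻¹ (quarkEquiv (f, p)) (quarkEquiv (f, q))‖ ^ 2 ≤
      B ^ (Nf - 2) * C ^ 2 := by
  have hdet : ‖(diracMatrix U (fun _ : Fin Nf => t)).det‖ =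
      ‖(wilsonDirac (fundamentalRep (Fin 3)) U t 1).det‖ ^ Nf := by
    rw [norm_det_diracMatrix, Finset.prod_const, Finset.card_univ, Fintype.card_fin]
  by_cases h0 : (wilsonDirac (fundamentalRep (Fin 3)) U t 1).det = 0
  · have h1 : ‖(diracMatrix U (fun _ : Fin Nf => t)).det‖ = 0 := by
      rw [hdet, h0, norm_zero, zero_pow (by omega)]
    rw [h1, zero_mul]
    exact mul_nonneg (pow_nonneg ((norm_nonneg _).trans hB) _) (sq_nonneg _)
  · rw [inv_diracMatrix_apply_same_flavour U (fun _ : Fin Nf => t) (fun _ => h0) f p q, hdet]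
    exact norm_det_pow_mul_norm_inv_sq_le _ p q hNf hB hC

/-- The degenerate-tuple bound with the constants supplied by compactness: `|det D_W(·,t,1)|` and
`|adj D_W(·,t,1)(p,q)|` are continuous on the compact configuration space, hence bounded. -/
theorem exists_norm_det_diracMatrix_mul_norm_inv_sq_le {Nf S : ℕ} [NeZero S] (hNf : 2 ≤ Nf) (t : ℝ)
    (f : Fin Nf) (p q : TorusSite 4 S × Fin 3 × Fin 4) :
    ∃ K : ℝ, ∀ U : GaugeConfig 4 S SU3,
      ‖(diracMatrix U (fun _ : Fin Nf => t)).det‖ *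
          ‖(diracMatrix U (fun _ : Fin Nf => t))⁻¹ (quarkEquiv (f, p)) (quarkEquiv (f, q))‖ ^ 2 ≤ K := by
  have hc : Continuous fun U : GaugeConfig 4 S SU3 => wilsonDirac (fundamentalRep (Fin 3)) U t 1 :=
    continuous_wilsonDirac (fundamentalRep (Fin 3)) (continuous_fundamentalRep (Fin 3)) t 1
  obtain ⟨U₁, -, hU₁⟩ := (isCompact_univ (X := GaugeConfig 4 S SU3)).exists_isMaxOn
    Set.univ_nonempty hc.matrix_det.norm.continuousOn
  obtain ⟨U₂, -, hU₂⟩ := (isCompact_univ (X := GaugeConfig 4 S SU3)).exists_isMaxOn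
    Set.univ_nonempty (hc.matrix_adjugate.matrix_elem p q).norm.continuousOn
  exact ⟨_, fun U => norm_det_diracMatrix_mul_norm_inv_sq_le hNf t f p q U (hU₁ (Set.mem_univ U))
    (hU₂ (Set.mem_univ U))⟩

/-! ### §3 Integrability of the squared propagator entries at a degenerate tuple, `N_f ≥ 2` -/

/-- Every squared same-flavour propagator entry `|D⁻¹((f,p),(f,q))|²` is integrable under the
phase-quenched probability measure of `N_f ≥ 2` degenerate flavours. -/
theorem integrable_norm_inv_diracMatrix_sq {Nf S : ℕ} [NeZero S] (hNf : 2 ≤ Nf) (β t : ℝ) (f : Fin Nf)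
    (p q : TorusSite 4 S × Fin 3 × Fin 4) :
    Integrable (fun U : GaugeConfig 4 S SU3 =>
        ‖(diracMatrix U (fun _ : Fin Nf => t))⁻¹ (quarkEquiv (f, p)) (quarkEquiv (f, q))‖ ^ 2)
      (qcdLatticeMeasure S β (fun _ : Fin Nf => t)) := by
  obtain ⟨K, hK⟩ := exists_norm_det_diracMatrix_mul_norm_inv_sq_le (S := S) hNf t f p q
  exact integrable_qcdLatticeMeasure_of_norm_det_mul_le β _ _
    ((measurable_inv_diracMatrix_apply _ _ _).norm.pow_const 2) (fun U => sq_nonneg _) hK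

/-- The colour–spin sum `Σ_{a,i,b,j} |G_f((x,a,i),(y,b,j))|²` is integrable under the phase-quenched
probability measure of `N_f ≥ 2` degenerate flavours. -/
theorem integrable_sum_norm_inv_diracMatrix_sq {Nf S : ℕ} [NeZero S] (hNf : 2 ≤ Nf) (β t : ℝ)
    (f : Fin Nf) (x y : TorusSite 4 S) :
    Integrable (fun U : GaugeConfig 4 S SU3 => ∑ a : Fin 3, ∑ i : Fin 4, ∑ b : Fin 3, ∑ j : Fin 4,
        ‖(diracMatrix U (fun _ : Fin Nf => t))⁻¹ (quarkEquiv (f, (x, a, i)))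
          (quarkEquiv (f, (y, b, j)))‖ ^ (2 : ℕ))
      (qcdLatticeMeasure S β (fun _ : Fin Nf => t)) := by
  refine integrable_finsetSum _ fun a _ => integrable_finsetSum _ fun i _ =>
    integrable_finsetSum _ fun b _ => integrable_finsetSum _ fun j _ => ?_
  exact integrable_norm_inv_diracMatrix_sq hNf β t f _ _

/-! ### §4 Real-number bookkeeping and the stub -/

/-- The phase-quenched expectation of a non-negative observable is non-negative. -/
theorem qcdPhaseQuenchedExpect_nonneg_of_nonneg {Nf S : ℕ} [NeZero S] (β : ℝ) (mq : Fin Nf → ℝ)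
    (φ : GaugeConfig 4 S SU3 → ℝ) (h : ∀ U, 0 ≤ φ U) : 0 ≤ qcdPhaseQuenchedExpect β S mq φ := by
  rw [qcdPhaseQuenchedExpect_eq_integral_qcdLatticeMeasure]
  exact integral_nonneg h

/-- Bookkeeping: from Lyapunov `E₊[Y^s] ≤ E₊[Y^2]^{s/2}` and `E₊[Y^2] ≤ 144 E₊[X]` to
`E₊[Y^s]^{2/s} ≤ 144 E₊[X]` (`(s/2)(2/s) = 1`). -/
theorem rpow_two_div_le_of_lyapunov {Nf S : ℕ} [NeZero S] (β : ℝ) (mq : Fin Nf → ℝ)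
    (Y X : GaugeConfig 4 S SU3 → ℝ) (hY : ∀ U, 0 ≤ Y U) {s : ℝ} (hs : 0 < s)
    (h1 : qcdPhaseQuenchedExpect β S mq (fun U => Y U ^ s) ≤
      qcdPhaseQuenchedExpect β S mq (fun U => Y U ^ (2 : ℝ)) ^ (s / 2))
    (h2 : qcdPhaseQuenchedExpect β S mq (fun U => Y U ^ (2 : ℝ)) ≤
      144 * qcdPhaseQuenchedExpect β S mq X) :
    qcdPhaseQuenchedExpect β S mq (fun U => Y U ^ s) ^ (2 / s) ≤
      144 * qcdPhaseQuenchedExpect β S mq X := by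
  have hEs : 0 ≤ qcdPhaseQuenchedExpect β S mq (fun U => Y U ^ s) :=
    qcdPhaseQuenchedExpect_nonneg_of_nonneg β mq _ fun U => Real.rpow_nonneg (hY U) _
  have hE2 : 0 ≤ qcdPhaseQuenchedExpect β S mq (fun U => Y U ^ (2 : ℝ)) :=
    qcdPhaseQuenchedExpect_nonneg_of_nonneg β mq _ fun U => Real.rpow_nonneg (hY U) _
  have hss : s / 2 * (2 / s) = 1 := by
    rw [div_mul_div_comm, mul_comm s 2, div_self (mul_ne_zero two_ne_zero hs.ne')]
  have h := Real.rpow_le_rpow hEs h1 (by positivity : (0 : ℝ) ≤ 2 / s)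
  rw [← Real.rpow_mul hE2, hss, Real.rpow_one] at h
  exact h.trans h2

/-- STUB C (moments). **At a DEGENERATE tuple with at least two flavours the `s`-moment of the entry sum
bounds the pion second moment from below**: `E₊[(Σ|G_f|)^s]^{2/s} ≤ 144 · E₊[Σ|G_f|²]`, `0 < s ≤ 1`
(Lyapunov under the phase-quenched probability measure — `(Σ|G|)²` is integrable there because
`|det D_t|^{N_f} (Σ|G_t|)² ≤ 144 |det D_t|^{N_f - 2} Σ|adj D_t|²` is bounded for `N_f ≥ 2` — and `(Σ g)² ≤ 144 Σ g²`). -/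
theorem stub_momentCompare :
    ∀ {Nf : ℕ}, 2 ≤ Nf → ∀ (β t : ℝ) (S : ℕ) (f : Fin Nf) (v : Site 4) {s : ℝ}, 0 < s → s ≤ 1 →
      fm Nf β (fun _ => t) S f v s ^ (2 / s) ≤
        144 * qcdPhaseQuenchedExpect β (2 * S + 1) (fun _ : Fin Nf => t)
          (fun U : GaugeConfig 4 (2 * S + 1) SU3 => ∑ a : Fin 3, ∑ i : Fin 4, ∑ b : Fin 3, ∑ j : Fin 4,
            ‖(diracMatrix U (fun _ : Fin Nf => t))⁻¹ (quarkEquiv (f, (Torus.proj (2 * S + 1) 0, a, i)))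
              (quarkEquiv (f, (Torus.proj (2 * S + 1) v, b, j)))‖ ^ (2 : ℕ)) := by
  intro Nf hNf β t S f v s hs hs1
  have hZ := integral_norm_det_diracMatrix_pos_all (S := 2 * S + 1) β (fun _ : Fin Nf => t)
  have hP0 := propSum_nonneg Nf S (fun _ : Fin Nf => t) f v
  -- integrability of the pion weight `X = Σ|G|²`
  have hXi := integrable_sum_norm_inv_diracMatrix_sq (S := 2 * S + 1) hNf β t f
    (Torus.proj (2 * S + 1) 0) (Torus.proj (2 * S + 1) v)
  -- `ℓ¹/ℓ²`: `P² ≤ 144 X` configuration-wise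
  have hPX : ∀ U : GaugeConfig 4 (2 * S + 1) SU3, propSum Nf S (fun _ : Fin Nf => t) f v U ^ (2 : ℝ) ≤
      144 * ∑ a : Fin 3, ∑ i : Fin 4, ∑ b : Fin 3, ∑ j : Fin 4,
        ‖(diracMatrix U (fun _ : Fin Nf => t))⁻¹ (quarkEquiv (f, (Torus.proj (2 * S + 1) 0, a, i)))
          (quarkEquiv (f, (Torus.proj (2 * S + 1) v, b, j)))‖ ^ (2 : ℕ) := fun U => by
    rw [Real.rpow_two]
    exact (MobilityGapPinch.sum_sq_le_sq_sum_le (fun a i b j =>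
      ‖(diracMatrix U (fun _ : Fin Nf => t))⁻¹ (quarkEquiv (f, (Torus.proj (2 * S + 1) 0, a, i)))
        (quarkEquiv (f, (Torus.proj (2 * S + 1) v, b, j)))‖) fun _ _ _ _ => norm_nonneg _).2
  -- integrability of `P^s` (landed, `s ≤ 1`) and of `P²` (domination by `144 X`)
  have hi' := integrable_propSum_rpow Nf S β (fun _ : Fin Nf => t) f v hs.le hs1
  have hi : Integrable (fun U => propSum Nf S (fun _ : Fin Nf => t) f v U ^ (2 : ℝ))
      (qcdLatticeMeasure (2 * S + 1) β (fun _ : Fin Nf => t)) :=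
    Integrable.mono' (hXi.const_mul 144)
      ((measurable_propSum Nf S (fun _ : Fin Nf => t) f v).pow_const _).aestronglyMeasurable
      (Eventually.of_forall fun U => by
        rw [Real.norm_eq_abs, abs_of_nonneg (Real.rpow_nonneg (hP0 U) _)]
        exact hPX U)
  -- Lyapunov `E₊[P^s] ≤ E₊[P²]^{s/2}`
  have hLyap := qcdPhaseQuenchedExpect_rpow_le_rpow (S := 2 * S + 1) β (fun _ : Fin Nf => t) hZ
    (propSum Nf S (fun _ : Fin Nf => t) f v) hP0 hs (show s ≤ (2 : ℝ) by linarith) hi' hi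
  -- monotonicity `E₊[P²] ≤ 144 E₊[X]`
  have h2 : qcdPhaseQuenchedExpect β (2 * S + 1) (fun _ : Fin Nf => t)
      (fun U => propSum Nf S (fun _ : Fin Nf => t) f v U ^ (2 : ℝ)) ≤
      144 * qcdPhaseQuenchedExpect β (2 * S + 1) (fun _ : Fin Nf => t)
        (fun U : GaugeConfig 4 (2 * S + 1) SU3 => ∑ a : Fin 3, ∑ i : Fin 4, ∑ b : Fin 3, ∑ j : Fin 4,
          ‖(diracMatrix U (fun _ : Fin Nf => t))⁻¹ (quarkEquiv (f, (Torus.proj (2 * S + 1) 0, a, i)))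
            (quarkEquiv (f, (Torus.proj (2 * S + 1) v, b, j)))‖ ^ (2 : ℕ)) := by
    rw [qcdPhaseQuenchedExpect_eq_integral_qcdLatticeMeasure,
      qcdPhaseQuenchedExpect_eq_integral_qcdLatticeMeasure, ← integral_const_mul]
    exact integral_mono hi (hXi.const_mul 144) hPX
  rw [negativeFm_eq_fm, fm_eq_expect]
  exact rpow_two_div_le_of_lyapunov β _ (propSum Nf S (fun _ : Fin Nf => t) f v) _ hP0 hs hLyap h2

end Summit.QuantumFields.QCD.Theorems.ChiralMobilityGapSketch

end
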